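import Literature.NumberTheory.DiophantineApproximation.PolylogHermitePade
import Literature.NumberTheory.DiophantineApproximation.DilogHermitePadeArithmetic
import HarnessLib

/-!
# Type-I Hermite–Padé forms for `1, Li₁(x), …, Li_w(x)` — the partial fraction expansion

Topic `Literature/NumberTheory/DiophantineApproximation`. For the weight-`w` kernel
`R^{(w)}_n(u) = (u − wn + 1)_{wn} / (u+1)_{n+1}^w` (`PolylogPade.kernelW`, vocabulary in
`PolylogHermitePade.lean`) we prove

* `kernelW_eq_prod_brickEval`: `R^{(w)}_n = ∏_{s<w} F_{s+1}` is the product of `w` of Rivoal's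
  bricks `F_l(u) = (u − nl + 1)_n/(u+1)_{n+1} = ∑_m (resF n l)_m/(u+m+1)`
  (`BallRivoal.F_eq_brickEval`; the numerator identity is `BallRivoal.poch_mul` reindexed by
  `L ↦ w − 1 − s`);
* `exists_pf_kernelW`: hence (`BallRivoal.exists_pf_prod` with `d = d_n = lcm(1, …, n)`) there are
  rationals `c_{o,p}` (`o < w`, `p ≤ n`) with
  `R^{(w)}_n(u) = ∑_{p ≤ n} ∑_{o<w} c_{o,p}/(u+p+1)^{o+1}` away from the poles,
  `d_n^{w−1−o} c_{o,p} ∈ ℤ` and `∑ |c_{o,p}| ≤ w! ∏_{s<w} 2^n C(n(s+2), n)`.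

References: S. David, N. Hirata-Kohno, M. Kawashima, Moscow J. Comb. Number Th. 9 (2020),
Thm 2.1 (the kernel); T. Rivoal, C. R. Acad. Sci. Paris 331 (2000), §2 proof of Lemme 5 (the
bricks `F_l` and their partial fractions).
-/

open Finset

namespace Literature.NumberTheory.DiophantineApproximation

namespace PolylogPade

open Literature.NumberTheory.Transcendental

/-- **The weight-`w` kernel is the product of its bricks**: for `u ∉ {−1, …, −(n+1)}`,
`R^{(w)}_n(u) = ∏_{s<w} F_{s+1}(u)` with `F_{s+1}(u) = ∑_m (bricksW n s)_m/(u+m+1)`, since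
`(u − wn + 1)_{wn} = ∏_{s<w} (u − n(s+1) + 1)_n` and `F_l(u) (u+1)_{n+1} = (u − nl + 1)_n`.
[cite: Rivoal2000, §2 proof of Lemme 5] -/
theorem kernelW_eq_prod_brickEval (w n : ℕ) (t : ℚ) (ht : ∀ m, m ≤ n → t + m + 1 ≠ 0) :
    kernelW w n t = ∏ s ∈ Finset.range w, BallRivoal.brickEval n (bricksW n s) t := by
  have hpoch : BallRivoal.poch (t + 1) (n + 1) ≠ 0 := by
    rw [BallRivoal.poch]
    exact prod_ne_zero_iff.2 fun m hm => by
      have := ht m (Nat.lt_succ_iff.1 (mem_range.1 hm))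
      intro h
      apply this
      linarith
  have hDr : BallRivoal.poch (t + 1) (n + 1) ^ w =
      ∏ _L ∈ range w, BallRivoal.poch (t + 1) (n + 1) := by
    rw [prod_const, card_range]
  have hF : ∏ L ∈ range w, BallRivoal.brickEval n (bricksW n L) t =
      BallRivoal.poch (t - w * n + 1) (w * n) / BallRivoal.poch (t + 1) (n + 1) ^ w := by
    rw [eq_div_iff (pow_ne_zero _ hpoch), BallRivoal.poch_mul, hDr, ← prod_mul_distrib]
    conv_rhs => rw [← prod_range_reflect]
    refine prod_congr rfl fun L hL => ?_
    have hL' : L < w := mem_range.1 hL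
    rw [bricksW, ← BallRivoal.F_eq_brickEval n (L + 1) t ht, div_mul_cancel₀ _ hpoch]
    congr 1
    rw [Nat.cast_sub (by omega : L ≤ w - 1), Nat.cast_sub (by omega : 1 ≤ w)]
    push_cast
    ring
  rw [hF, kernelW]

/-- **Partial fractions of the weight-`w` kernel**: for `1 ≤ w` there are rationals `c_{o,p}`
(`o < w`, `p ≤ n`) with `R^{(w)}_n(u) = ∑_{p ≤ n} ∑_{o<w} c_{o,p}/(u+p+1)^{o+1}` for
`u ∉ {−1, …, −(n+1)}`, `d_n^{w−1−o} c_{o,p} ∈ ℤ` (`d_n = lcm(1, …, n)`), and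
`∑ |c_{o,p}| ≤ w! ∏_{s<w} 2^n C(n(s+2), n)` — `BallRivoal.exists_pf_prod` applied to the bricks
`F_1, …, F_w` of `kernelW_eq_prod_brickEval`, with `∑_m |(resF n (s+1))_m| ≤ 2^n C(n(s+2), n)`.
[cite: DavidHirataKohnoKawashima2020, Thm 2.1] -/
theorem exists_pf_kernelW (w n : ℕ) (hw : 1 ≤ w) :
    ∃ c : ℕ → ℕ → ℚ,
      (∀ t : ℚ, (∀ m, m ≤ n → t + m + 1 ≠ 0) → BallRivoal.pfEval n w c t = kernelW w n t) ∧
      BallRivoal.IsInt w (Nat.lcmUpto n) c ∧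
      BallRivoal.l1 n w c ≤ (w.factorial : ℚ) *
        ∏ s ∈ Finset.range w, ((2 : ℚ) ^ n * ((n * (s + 2)).choose n : ℚ)) := by
  have hdiv : ∀ k : ℕ, 1 ≤ k → k ≤ n → (k : ℤ) ∣ (Nat.lcmUpto n : ℤ) :=
    fun k h1 h2 => DilogPade.natCast_dvd_lcmUpto h1 h2
  obtain ⟨c, hc, hint, hl1⟩ :=
    BallRivoal.exists_pf_prod n (Nat.lcmUpto n) hdiv (bricksW n) w hw
  refine ⟨c, fun t ht => ?_, hint, hl1.trans ?_⟩
  · rw [hc t ht, kernelW_eq_prod_brickEval w n t ht]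
  · refine mul_le_mul_of_nonneg_left ?_ (by positivity)
    refine prod_le_prod (fun s _ => sum_nonneg fun _ _ => abs_nonneg _) fun s _ => ?_
    exact BallRivoal.sum_abs_resF_le n (s + 1)

end PolylogPade

end Literature.NumberTheory.DiophantineApproximation
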